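import Mathlib
import Literature.NumberTheory.LFunctions.Zhang2022.Section14Eq148Leg1Twisted
import HarnessLib

/-!
# Zhang (2022) §14, the (14.8)-type majorants at a general modulus base `N`: the small-conductor
# range `r < D³` ("Mellin transform, Lemma 5.4 (i) and Lemma 5.6") is `≪ P²D^{−A}` — `N`-generic core

Topic `Literature/NumberTheory/LFunctions/Zhang2022` (Landau–Siegel audit tree; verdict-neutral).
Y. Zhang, *Discrete mean estimates and the Landau–Siegel zero*, arXiv:2211.02515v1 (2022)
[Zhang2022LandauSiegel] — **an unrefereed manuscript under adjudication; nothing here asserts or denies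
its Theorems 1–2 or Proposition 14.1.** ZHANG-L discharge lane (WP14; helper under the leaf
`Skeleton.Prop141` at general `β`; GAP rows G-adj2-4 / G-L3t7-1; WP14-PLAN §2.1 "CORE-small", §2.2 (i)–(iii)).

After the re-indexing of the non-principal characters `θ (mod Nk)` by conductor (`Typed.Sec14`
`step14u017`-type lemmas; `N = D` for (14.5)/(14.8), `N = D₂` for (14.6) "is analogous", p. 79 tex
L3966–L3969), every (14.8)-type majorant of §14 has the shape
`Σ_{d≤2P₄} d⁻¹ Σ_{r} Σ_{h} N/(φ(hr)h√r) Σ_{θ* mod r, θ≠χ} ‖Σ_{(l,h)=1} κ*(D₁dl)θ(l) Σ_{p∼P} χθ̄(p)(pt₀)^β Δ(l/(phr))‖`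
with a modulus base `N`, a coefficient dilation `D₁` (`= 1` resp. the factor `D₁ > 1` of `D = D₁D₂`) and
an `h`-range inside `Ico 1 ⌈P/r⌉` (the divisibility filters only shrink it). This file proves the
small-conductor range `r < D³` of that shape ONCE, for every power `A` of `D`:

* `coreSmall_sum_le` — for every `A`, `B`: `… ≤ C·P²·D^{−A}` eventually, uniformly in `|β| ≤ 5α`, `N ≤ D`,
  `D₁ ≤ D`, any `S ⊆ {2 ≤ r < D³}` and any `G r ⊆ Ico 1 ⌈P/r⌉`; the proof is the aggregation of
  `eq148leg1W_holds` (`Section14Eq148Leg1Twisted`) verbatim over the per-character bound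
  `smallConductor_tsum_le_wt` at `A + 12` (the dilation costs `d(D₁d)⁴ ≤ D₁⁴d(d)⁴ ≤ D⁴d(d)⁴`, the
  prefactor `N ≤ D`, `r ≤ D³`, `#S ≤ D³`).

Instances (for the node owners; a few lines each): W-leg1 = `N := D`, `D₁ := 1` (landed separately as
`eq148leg1W_holds`); the hypothesis `hleg1` of `Typed.Sec14.eq146W_of_legs` = `N := D₂`, `D₁` with
`D₁D₂ = D`, `S := (Icc 2 ⌊2D₂P₄⌋).filter (r < D³)`, `G r := (Ico 1 ⌈P/r⌉).filter (D₂/(D₂,r) ∣ ·)`.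
Theorems only; no new definitions; inputs are tree theorems.

## References

* Y. Zhang, arXiv:2211.02515v1 (2022), §14 Prop. 14.1 p. 76; (14.8) and its proof sentence p. 79
  (tex L3945–L3962); (14.6) p. 79 (tex L3966–L3969). [cite: Zhang2022LandauSiegel, §14 (14.8), (14.6) p.79]
-/

noncomputable section

open Complex Real

namespace Literature.NumberTheory.LFunctions.Zhang2022.Typed.Sec14

open Skeleton

/-- The harmonic bound on `Ico`: `Σ_{1 ≤ h < M} 1/h ≤ 1 + log M`. [folklore] -/
private theorem sum_Ico_one_div_le₃ (M : ℕ) : ∑ h ∈ Finset.Ico 1 M, (1 : ℝ) / h ≤ 1 + Real.log M := by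
  calc ∑ h ∈ Finset.Ico 1 M, (1 : ℝ) / h ≤ ∑ h ∈ Finset.Icc 1 M, (1 : ℝ) / h :=
        Finset.sum_le_sum_of_subset_of_nonneg
          (fun h hh => by
            rw [Finset.mem_Ico] at hh; rw [Finset.mem_Icc]; omega)
          (fun _ _ _ => by positivity)
    _ ≤ 1 + Real.log M := sum_Icc_one_div_le_one_add_log M

set_option maxHeartbeats 400000 in
/-- **CORE-small, `N`-generic** (the small-conductor `r < D³` range of the (14.8)-type majorants at
modulus base `N`: `N = D` for (14.5)/(14.8), `N = D₂` for (14.6); p. 79 tex L3960–L3962 "for `1 < r < D³`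
we use the Mellin transform, Lemma 5.4 (i) and Lemma 5.6", at general `β`, "the general case is almost
identical" p. 76). For every `A`, `B` there is `C ≥ 0` such that for all large `D` under (A), all
`|β| ≤ 5α`, all `κ*` with (14.1), every modulus base `N ≤ D`, every dilation `D₁ ≤ D` of the
coefficients (`κ*(D₁d·)`), every `r`-set `S` with `2 ≤ r < D³` on `S`, and every family of `h`-index sets
`G r ⊆ Ico 1 ⌈P/r⌉` (the divisibility filters `N/(N,r) ∣ h` of the instances are dropped here — they only
shrink a sum of non-negative terms):
`Σ_{d≤2P₄} d⁻¹ Σ_{r∈S} Σ_{h∈G r} N/(φ(hr)h√r) Σ_{θ* mod r, θ≠χ} ‖Σ_{(l,h)=1} κ*(D₁dl)θ(l) Σ_{p∼P} χθ̄(p)(pt₀)^β Δ(l/(phr))‖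
 ≤ C·P²·D^{−A}`. Per character: `smallConductor_tsum_le_wt` at `A + 12` (`d(D₁d)⁴ ≤ D₁⁴d(d)⁴ ≤ D⁴d(d)⁴`);
then `#θ* ≤ φ(r) ≤ r`, `√r ≥ 1`, `hr/φ(hr) ≤ (1 + log hr)² ≤ 4𝓛¹⁸`, `N ≤ D`, `r ≤ D³`, `Σ_{h<P/r} 1/h ≤ 3𝓛⁹`,
`#S ≤ D³`, `Σ_{d≤2P₄} d(d)⁴/d ≤ (2𝓛⁹)¹⁶`, and `12·2¹⁶C₀𝓛¹⁷¹ ≤ D` (`C = 1`). Instances: W-leg1 (`N = D`,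
`D₁ = 1`, `eq148leg1W_holds`), `hleg1` of `eq146W_of_legs` (`N = D₂`, `D₁D₂ = D`).
[cite: Zhang2022LandauSiegel, §14 Prop. 14.1 p.76; (14.8) p.79, tex L3945–L3962; (14.6) p.79, tex L3966–L3969] -/
theorem coreSmall_sum_le (A : ℕ) (B : ℝ) :
    ∃ C : ℝ, 0 ≤ C ∧ ForAllLarge fun D _ χ => AssumptionA D χ → ∀ β : ℂ, ‖β‖ ≤ 5 * alpha D →
      ∀ κs : ℕ → ℂ, Eq141 B κs → ∀ (N D₁ : ℕ), N ≤ D → D₁ ≤ D →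
      ∀ S : Finset ℕ, (∀ r ∈ S, 2 ≤ r ∧ r < D ^ 3) →
      ∀ G : ℕ → Finset ℕ, (∀ r ∈ S, G r ⊆ Finset.Ico 1 ⌈bigP D / r⌉₊) →
        ∑ d ∈ Finset.Icc 1 ⌊2 * P4 D⌋₊, (d : ℝ)⁻¹ * ∑ r ∈ S, ∑ h ∈ G r,
            (N : ℝ) / ((Nat.totient (h * r) : ℝ) * h * Real.sqrt r) *
              ∑ θ ∈ finsetOf {θ : DirichletCharacter ℂ r | θ.IsPrimitive ∧
                  DirichletCharacter.changeLevel (dvd_mul_left r D) θ ≠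
                    DirichletCharacter.changeLevel (dvd_mul_right D r) χ},
                ‖∑' l : ℕ, if Nat.Coprime l h then
                    κs (D₁ * d * l) * θ (l : ZMod r) *
                      ∑ p ∈ primeWindow D, χ (p : ZMod D) * θ⁻¹ (p : ZMod r) * wt D β p *
                        DeltaW D ((l : ℝ) / ((p : ℝ) * h * r)) else 0‖
          ≤ C * bigP D ^ 2 * (D : ℝ) ^ (-(A : ℝ)) := by
  classical
  obtain ⟨C₀, hC₀0, DS, hS⟩ := smallConductor_tsum_le_wt (A + 12) B
  obtain ⟨DP4, hP4⟩ := exists_two_mul_P4_le_bigP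
  obtain ⟨Dℓ, hℓ2⟩ := exists_nat_forall_le_ell 2
  obtain ⟨Dabs, habs⟩ := exists_mul_ell_pow_le 171 (show (0 : ℝ) ≤ 12 * 2 ^ 16 * C₀ by positivity)
  refine ⟨1, zero_le_one, DS + DP4 + Dℓ + Dabs + 3,
    fun D _ χ hD hq hp hA β hβ κs hκ N D₁ hND hD₁D S hSr G hG => ?_⟩
  have hD3 : 3 ≤ D := by omega
  have hD0 : (0 : ℝ) < D := by exact_mod_cast (show 0 < D by omega)
  have hD1 : (1 : ℝ) ≤ D := by exact_mod_cast (show 1 ≤ D by omega)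
  have hℓ2' : 2 ≤ ell D := hℓ2 D (by omega)
  have hℓ1 : 1 ≤ ell D := by linarith
  have hP0 : 0 < bigP D := Real.exp_pos _
  have hP1 : 1 ≤ bigP D := Real.one_le_exp (by positivity)
  have hlogP : Real.log (bigP D) = ell D ^ 9 := by rw [bigP, Real.log_exp]
  have h9 : (2 : ℝ) ≤ ell D ^ 9 := le_trans hℓ2' (le_self_pow₀ hℓ1 (by norm_num))
  have hlog2 : Real.log 2 ≤ 1 := by
    have := Real.log_le_sub_one_of_pos (show (0 : ℝ) < 2 by norm_num); linarith
  have hN : (N : ℝ) ≤ D := by exact_mod_cast hND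
  have hD₁ : (D₁ : ℝ) ≤ D := by exact_mod_cast hD₁D
  set L : ℝ := ell D with hL
  set P : ℝ := bigP D with hPdef
  -- the per-character bound, as a function of `(d, h, r)`
  set BND : ℕ → ℕ → ℕ → ℝ := fun d h r =>
    C₀ * ((D : ℝ) ^ 4 * (d.divisors.card : ℝ) ^ 4) * ((h * r : ℕ) : ℝ) * P ^ 2 *
      (D : ℝ) ^ (-((A + 12 : ℕ) : ℝ)) with hBND
  have hBND0 : ∀ d h r, 0 ≤ BND d h r := fun d h r => by simp only [hBND]; positivity
  -- the dilation costs `d(D₁d)⁴ ≤ D⁴·d(d)⁴`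
  have hdil : ∀ d : ℕ, ((D₁ * d).divisors.card : ℝ) ^ 4 ≤ (D : ℝ) ^ 4 * (d.divisors.card : ℝ) ^ 4 := by
    intro d
    have h1 : ((D₁ * d).divisors.card : ℝ) ≤ (D₁.divisors.card : ℝ) * d.divisors.card := by
      rw [Nat.divisors_mul]; exact_mod_cast Finset.card_mul_le
    have h2 : (D₁.divisors.card : ℝ) ≤ D :=
      le_trans (by exact_mod_cast Nat.card_divisors_le_self D₁) hD₁
    calc ((D₁ * d).divisors.card : ℝ) ^ 4 ≤ ((D₁.divisors.card : ℝ) * d.divisors.card) ^ 4 :=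
          pow_le_pow_left₀ (by positivity) h1 4
      _ ≤ ((D : ℝ) * d.divisors.card) ^ 4 :=
          pow_le_pow_left₀ (by positivity) (mul_le_mul_of_nonneg_right h2 (by positivity)) 4
      _ = (D : ℝ) ^ 4 * (d.divisors.card : ℝ) ^ 4 := by ring
  -- Step 1: one character
  have hchar : ∀ (d r h : ℕ) (θ : DirichletCharacter ℂ r), r ∈ S → h ∈ G r →
      θ ∈ finsetOf {θ : DirichletCharacter ℂ r | θ.IsPrimitive ∧
          DirichletCharacter.changeLevel (dvd_mul_left r D) θ ≠
            DirichletCharacter.changeLevel (dvd_mul_right D r) χ} →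
      ‖∑' l : ℕ, if Nat.Coprime l h then
          κs (D₁ * d * l) * θ (l : ZMod r) *
            ∑ p ∈ primeWindow D, χ (p : ZMod D) * θ⁻¹ (p : ZMod r) * wt D β p *
              DeltaW D ((l : ℝ) / ((p : ℝ) * h * r)) else 0‖ ≤ BND d h r := by
    intro d r h θ hr hh hθ
    obtain ⟨hr2, hr3⟩ := hSr r hr
    have hh1 : h ∈ Finset.Ico 1 ⌈bigP D / r⌉₊ := hG r hr hh
    obtain ⟨hh0, hhP⟩ := Finset.mem_Ico.mp hh1
    obtain ⟨hθp, hne⟩ := mem_of_mem_finsetOf hθ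
    have hr0 : (0 : ℝ) < r := by exact_mod_cast (show 0 < r by omega)
    have hrD : (r : ℝ) < (D : ℝ) ^ 3 := by exact_mod_cast hr3
    have hhr : ((h * r : ℕ) : ℝ) ≤ bigP D := by
      have h1 : (h : ℝ) < bigP D / r := Nat.lt_ceil.mp hhP
      rw [lt_div_iff₀ hr0] at h1
      push_cast; exact h1.le
    have hSeq : ∀ l : ℕ, (∑ p ∈ primeWindow D, χ (p : ZMod D) * θ⁻¹ (p : ZMod r) * wt D β p *
        DeltaW D ((l : ℝ) / ((p : ℝ) * h * r))) =
        ∑ p ∈ primeWindow D, χ (p : ZMod D) * θ⁻¹ (p : ZMod r) * wt D β p *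
          DeltaW D ((l : ℝ) / ((p : ℝ) * ((h * r : ℕ) : ℝ))) := by
      intro l
      refine Finset.sum_congr rfl fun p _ => ?_
      simp only [Nat.cast_mul, mul_assoc]
    refine le_trans (hS D χ (by omega) hq hp hA β hβ κs hκ (D₁ * d) r h θ (by omega) hrD (by omega) hhr
      hθp hne _ ?_) ?_
    · intro l
      rw [← hSeq l]
      split_ifs with hc
      · rw [norm_mul, norm_mul]
        calc ‖κs (D₁ * d * l)‖ * ‖θ (l : ZMod r)‖ * _ ≤ ‖κs (D₁ * d * l)‖ * 1 * _ := by
              gcongr; exact DirichletCharacter.norm_le_one _ _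
          _ = _ := by rw [mul_one]
      · rw [norm_zero]; positivity
    · have hfac : 0 ≤ C₀ := hC₀0
      have hrest : 0 ≤ ((h * r : ℕ) : ℝ) * bigP D ^ 2 * (D : ℝ) ^ (-((A + 12 : ℕ) : ℝ)) := by
        positivity
      calc C₀ * ((D₁ * d).divisors.card : ℝ) ^ 4 * ((h * r : ℕ) : ℝ) * bigP D ^ 2 *
            (D : ℝ) ^ (-((A + 12 : ℕ) : ℝ))
          = C₀ * ((D₁ * d).divisors.card : ℝ) ^ 4 *
              (((h * r : ℕ) : ℝ) * bigP D ^ 2 * (D : ℝ) ^ (-((A + 12 : ℕ) : ℝ))) := by ring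
        _ ≤ C₀ * ((D : ℝ) ^ 4 * (d.divisors.card : ℝ) ^ 4) *
              (((h * r : ℕ) : ℝ) * bigP D ^ 2 * (D : ℝ) ^ (-((A + 12 : ℕ) : ℝ))) :=
            mul_le_mul_of_nonneg_right (mul_le_mul_of_nonneg_left (hdil d) hfac) hrest
        _ = BND d h r := by simp only [hBND]; ring
  -- Step 2: the sum over the characters at `(d, r, h)` is `≤ r · BND`
  have hθsum : ∀ (d r h : ℕ), r ∈ S → h ∈ G r →
      (∑ θ ∈ finsetOf {θ : DirichletCharacter ℂ r | θ.IsPrimitive ∧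
          DirichletCharacter.changeLevel (dvd_mul_left r D) θ ≠
            DirichletCharacter.changeLevel (dvd_mul_right D r) χ},
        ‖∑' l : ℕ, if Nat.Coprime l h then
            κs (D₁ * d * l) * θ (l : ZMod r) *
              ∑ p ∈ primeWindow D, χ (p : ZMod D) * θ⁻¹ (p : ZMod r) * wt D β p *
                DeltaW D ((l : ℝ) / ((p : ℝ) * h * r)) else 0‖) ≤ (r : ℝ) * BND d h r := by
    intro d r h hr hh
    have hr2 : 2 ≤ r := (hSr r hr).1
    haveI : NeZero r := ⟨by omega⟩
    set T := finsetOf {θ : DirichletCharacter ℂ r | θ.IsPrimitive ∧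
          DirichletCharacter.changeLevel (dvd_mul_left r D) θ ≠
            DirichletCharacter.changeLevel (dvd_mul_right D r) χ} with hT
    have h1 := Finset.sum_le_card_nsmul T _ (BND d h r) (fun θ hθ => hchar d r h θ hr hh hθ)
    rw [nsmul_eq_mul] at h1
    refine h1.trans (mul_le_mul_of_nonneg_right ?_ (hBND0 d h r))
    have hcard : T.card ≤ Fintype.card (DirichletCharacter ℂ r) := Finset.card_le_univ _
    have htot : Fintype.card (DirichletCharacter ℂ r) = r.totient := by
      rw [← Nat.card_eq_fintype_card, DirichletCharacter.card_eq_totient_of_hasEnoughRootsOfUnity ℂ r]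
    calc (T.card : ℝ) ≤ (Fintype.card (DirichletCharacter ℂ r) : ℝ) := by exact_mod_cast hcard
      _ = (r.totient : ℝ) := by rw [htot]
      _ ≤ r := by exact_mod_cast Nat.totient_le r
  -- Step 3: the weighted `(d, r, h)` term is `≤ M · d(d)⁴ · (1/h)`
  set M : ℝ := 4 * L ^ 18 * C₀ * P ^ 2 * (D : ℝ) ^ (-((A + 12 : ℕ) : ℝ)) * (D : ℝ) ^ 4 * (D : ℝ) *
    (D : ℝ) ^ 3 with hM
  have hM0 : 0 ≤ M := by positivity
  have hterm : ∀ (d r h : ℕ), r ∈ S → h ∈ G r →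
      (N : ℝ) / ((Nat.totient (h * r) : ℝ) * h * Real.sqrt r) * ((r : ℝ) * BND d h r) ≤
        M * (d.divisors.card : ℝ) ^ 4 * (1 / (h : ℝ)) := by
    intro d r h hr hh
    obtain ⟨hr2, hr3⟩ := hSr r hr
    have hh1 : h ∈ Finset.Ico 1 ⌈bigP D / r⌉₊ := hG r hr hh
    obtain ⟨hh0, hhP⟩ := Finset.mem_Ico.mp hh1
    have hr0 : (0 : ℝ) < r := by exact_mod_cast (show 0 < r by omega)
    have hh0' : (0 : ℝ) < h := by exact_mod_cast hh0
    have hrD : (r : ℝ) ≤ (D : ℝ) ^ 3 := by exact_mod_cast hr3.le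
    have hhr0 : (0 : ℝ) < ((h * r : ℕ) : ℝ) := by exact_mod_cast Nat.mul_pos hh0 (by omega)
    have hhrP : ((h * r : ℕ) : ℝ) ≤ bigP D := by
      have h1 : (h : ℝ) < bigP D / r := Nat.lt_ceil.mp hhP
      rw [lt_div_iff₀ hr0] at h1
      push_cast; exact h1.le
    have htot0 : (0 : ℝ) < (Nat.totient (h * r) : ℝ) := by
      exact_mod_cast Nat.totient_pos.2 (Nat.mul_pos hh0 (by omega))
    have hsqrt1 : (1 : ℝ) ≤ Real.sqrt r := by
      rw [show (1 : ℝ) = Real.sqrt 1 from Real.sqrt_one.symm]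
      exact Real.sqrt_le_sqrt (by exact_mod_cast (show 1 ≤ r by omega))
    -- `hr ≤ 4𝓛¹⁸ φ(hr)`
    have hweight : ((h * r : ℕ) : ℝ) ≤ 4 * L ^ 18 * (Nat.totient (h * r) : ℝ) := by
      have hnat := Literature.NumberTheory.Sieve.natCast_div_totient_le (h * r)
      rw [div_le_iff₀ htot0] at hnat
      have hlog : Real.log ((h * r : ℕ) : ℝ) ≤ L ^ 9 := by
        calc Real.log ((h * r : ℕ) : ℝ) ≤ Real.log (bigP D) := Real.log_le_log hhr0 hhrP
          _ = L ^ 9 := hlogP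
      have hlog0 : 0 ≤ Real.log ((h * r : ℕ) : ℝ) := Real.log_natCast_nonneg _
      have h19 : (1 : ℝ) ≤ L ^ 9 := one_le_pow₀ hℓ1
      have hsq : (1 + Real.log ((h * r : ℕ) : ℝ)) ^ 2 ≤ 4 * L ^ 18 := by
        calc (1 + Real.log ((h * r : ℕ) : ℝ)) ^ 2 ≤ (2 * L ^ 9) ^ 2 :=
              pow_le_pow_left₀ (by linarith) (by linarith) 2
          _ = 4 * L ^ 18 := by ring
      exact hnat.trans (mul_le_mul_of_nonneg_right hsq htot0.le)
    -- the comparison, cleared of denominators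
    have hden : (0 : ℝ) < (Nat.totient (h * r) : ℝ) * h * Real.sqrt r := by positivity
    rw [div_mul_eq_mul_div, div_le_iff₀ hden]
    have hcore : (r : ℝ) * ((h * r : ℕ) : ℝ) * 1 ≤
        (D : ℝ) ^ 3 * (4 * L ^ 18 * (Nat.totient (h * r) : ℝ)) * Real.sqrt r :=
      mul_le_mul (mul_le_mul hrD hweight hhr0.le (by positivity)) hsqrt1 zero_le_one
        (by positivity)
    have hfac : 0 ≤ (D : ℝ) * C₀ * ((D : ℝ) ^ 4 * (d.divisors.card : ℝ) ^ 4) * P ^ 2 *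
        (D : ℝ) ^ (-((A + 12 : ℕ) : ℝ)) := by positivity
    have hh1' : (1 / (h : ℝ)) * ((Nat.totient (h * r) : ℝ) * h * Real.sqrt r) =
        (Nat.totient (h * r) : ℝ) * Real.sqrt r := by
      field_simp
    have hrB0 : 0 ≤ (r : ℝ) * BND d h r := mul_nonneg hr0.le (hBND0 d h r)
    calc (N : ℝ) * ((r : ℝ) * BND d h r)
        ≤ (D : ℝ) * ((r : ℝ) * BND d h r) := mul_le_mul_of_nonneg_right hN hrB0
      _ = ((D : ℝ) * C₀ * ((D : ℝ) ^ 4 * (d.divisors.card : ℝ) ^ 4) * P ^ 2 *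
            (D : ℝ) ^ (-((A + 12 : ℕ) : ℝ))) * ((r : ℝ) * ((h * r : ℕ) : ℝ) * 1) := by
          simp only [hBND]; ring
      _ ≤ ((D : ℝ) * C₀ * ((D : ℝ) ^ 4 * (d.divisors.card : ℝ) ^ 4) * P ^ 2 *
            (D : ℝ) ^ (-((A + 12 : ℕ) : ℝ))) *
            ((D : ℝ) ^ 3 * (4 * L ^ 18 * (Nat.totient (h * r) : ℝ)) * Real.sqrt r) :=
          mul_le_mul_of_nonneg_left hcore hfac
      _ = M * (d.divisors.card : ℝ) ^ 4 * ((Nat.totient (h * r) : ℝ) * Real.sqrt r) := by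
          simp only [hM]; ring
      _ = M * (d.divisors.card : ℝ) ^ 4 * (1 / (h : ℝ)) *
            ((Nat.totient (h * r) : ℝ) * h * Real.sqrt r) := by
          rw [mul_assoc (M * (d.divisors.card : ℝ) ^ 4) (1 / (h : ℝ)), hh1']
  -- Step 4: the sum over `h` at fixed `(d, r)`
  have hsumh : ∀ (d r : ℕ), r ∈ S →
      (∑ h ∈ G r,
        (N : ℝ) / ((Nat.totient (h * r) : ℝ) * h * Real.sqrt r) *
          ∑ θ ∈ finsetOf {θ : DirichletCharacter ℂ r | θ.IsPrimitive ∧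
              DirichletCharacter.changeLevel (dvd_mul_left r D) θ ≠
                DirichletCharacter.changeLevel (dvd_mul_right D r) χ},
            ‖∑' l : ℕ, if Nat.Coprime l h then
                κs (D₁ * d * l) * θ (l : ZMod r) *
                  ∑ p ∈ primeWindow D, χ (p : ZMod D) * θ⁻¹ (p : ZMod r) * wt D β p *
                    DeltaW D ((l : ℝ) / ((p : ℝ) * h * r)) else 0‖) ≤
        M * (d.divisors.card : ℝ) ^ 4 * (3 * L ^ 9) := by
    intro d r hr
    have hr2 : 2 ≤ r := (hSr r hr).1
    have hr0 : (0 : ℝ) < r := by exact_mod_cast (show 0 < r by omega)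
    have hN0 : (0 : ℝ) ≤ N := Nat.cast_nonneg N
    calc (∑ h ∈ G r, (N : ℝ) / ((Nat.totient (h * r) : ℝ) * h * Real.sqrt r) * _)
        ≤ ∑ h ∈ G r, (N : ℝ) / ((Nat.totient (h * r) : ℝ) * h * Real.sqrt r) * ((r : ℝ) * BND d h r) := by
          refine Finset.sum_le_sum fun h hh => ?_
          exact mul_le_mul_of_nonneg_left (hθsum d r h hr hh) (by positivity)
      _ ≤ ∑ h ∈ G r, M * (d.divisors.card : ℝ) ^ 4 * (1 / (h : ℝ)) :=
          Finset.sum_le_sum fun h hh => hterm d r h hr hh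
      _ ≤ ∑ h ∈ Finset.Ico 1 ⌈bigP D / r⌉₊, M * (d.divisors.card : ℝ) ^ 4 * (1 / (h : ℝ)) :=
          Finset.sum_le_sum_of_subset_of_nonneg (hG r hr) (fun _ _ _ => by positivity)
      _ = M * (d.divisors.card : ℝ) ^ 4 * ∑ h ∈ Finset.Ico 1 ⌈bigP D / r⌉₊, (1 / (h : ℝ)) := by
          rw [Finset.mul_sum]
      _ ≤ M * (d.divisors.card : ℝ) ^ 4 * (3 * L ^ 9) := by
          refine mul_le_mul_of_nonneg_left ?_ (by positivity)
          refine (sum_Ico_one_div_le₃ _).trans ?_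
          have hceil : (⌈bigP D / r⌉₊ : ℝ) ≤ 2 * bigP D := by
            have h1 : (⌈bigP D / r⌉₊ : ℝ) < bigP D / r + 1 := Nat.ceil_lt_add_one (by positivity)
            have h2 : bigP D / r ≤ bigP D := div_le_self hP0.le (by exact_mod_cast (show 1 ≤ r by omega))
            linarith
          rcases Nat.eq_zero_or_pos ⌈bigP D / r⌉₊ with h0 | hpos
          · rw [h0]; simp; nlinarith
          · have hlog : Real.log (⌈bigP D / r⌉₊ : ℝ) ≤ Real.log 2 + L ^ 9 := by
              calc Real.log (⌈bigP D / r⌉₊ : ℝ) ≤ Real.log (2 * bigP D) :=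
                    Real.log_le_log (by exact_mod_cast hpos) hceil
                _ = Real.log 2 + L ^ 9 := by rw [Real.log_mul (by norm_num) hP0.ne', hlogP]
            linarith
  -- Step 5: the sum over `r ∈ S` (at most `D³` terms)
  have hcardS : (S.card : ℝ) ≤ (D : ℝ) ^ 3 := by
    have h1 : S ⊆ Finset.range (D ^ 3) := fun r hr => by
      rw [Finset.mem_range]; exact (hSr r hr).2
    have h2 := Finset.card_le_card h1
    rw [Finset.card_range] at h2
    exact_mod_cast h2
  have hsumr : ∀ d : ℕ,
      (∑ r ∈ S, ∑ h ∈ G r,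
        (N : ℝ) / ((Nat.totient (h * r) : ℝ) * h * Real.sqrt r) *
          ∑ θ ∈ finsetOf {θ : DirichletCharacter ℂ r | θ.IsPrimitive ∧
              DirichletCharacter.changeLevel (dvd_mul_left r D) θ ≠
                DirichletCharacter.changeLevel (dvd_mul_right D r) χ},
            ‖∑' l : ℕ, if Nat.Coprime l h then
                κs (D₁ * d * l) * θ (l : ZMod r) *
                  ∑ p ∈ primeWindow D, χ (p : ZMod D) * θ⁻¹ (p : ZMod r) * wt D β p *
                    DeltaW D ((l : ℝ) / ((p : ℝ) * h * r)) else 0‖) ≤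
        (D : ℝ) ^ 3 * (M * (d.divisors.card : ℝ) ^ 4 * (3 * L ^ 9)) := by
    intro d
    have h1 := Finset.sum_le_card_nsmul S _ (M * (d.divisors.card : ℝ) ^ 4 * (3 * L ^ 9))
      (fun r hr => hsumh d r hr)
    rw [nsmul_eq_mul] at h1
    exact h1.trans (mul_le_mul_of_nonneg_right hcardS (by positivity))
  -- Step 6: the sum over `d`
  have hlog2P4 : 1 + Real.log (⌊2 * P4 D⌋₊ : ℝ) ≤ 2 * L ^ 9 := by
    have hP4' : 2 * P4 D ≤ bigP D := hP4 D (by omega)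
    rcases Nat.eq_zero_or_pos ⌊2 * P4 D⌋₊ with h0 | hpos
    · rw [h0]; simp; linarith
    · have hT0 : 0 < bigT D := Real.exp_pos _
      have ht00 : 0 ≤ t0 D := by rw [t0]; exact pow_nonneg (by linarith) _
      have h2P4 : 0 ≤ 2 * P4 D := by rw [P4]; positivity
      have hfl : (⌊2 * P4 D⌋₊ : ℝ) ≤ bigP D := (Nat.floor_le h2P4).trans hP4'
      have : Real.log (⌊2 * P4 D⌋₊ : ℝ) ≤ L ^ 9 := by
        rw [← hlogP]; exact Real.log_le_log (by exact_mod_cast hpos) hfl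
      linarith
  have hsumd : ∑ d ∈ Finset.Icc 1 ⌊2 * P4 D⌋₊, (d : ℝ)⁻¹ *
      ((D : ℝ) ^ 3 * (M * (d.divisors.card : ℝ) ^ 4 * (3 * L ^ 9))) ≤
      (D : ℝ) ^ 3 * M * (3 * L ^ 9) * (2 * L ^ 9) ^ 16 := by
    have e1 : ∑ d ∈ Finset.Icc 1 ⌊2 * P4 D⌋₊, (d : ℝ)⁻¹ *
        ((D : ℝ) ^ 3 * (M * (d.divisors.card : ℝ) ^ 4 * (3 * L ^ 9))) =
        (D : ℝ) ^ 3 * M * (3 * L ^ 9) *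
          ∑ d ∈ Finset.Icc 1 ⌊2 * P4 D⌋₊, (d.divisors.card : ℝ) ^ 4 / d := by
      rw [Finset.mul_sum]
      exact Finset.sum_congr rfl fun d _ => by rw [div_eq_mul_inv]; ring
    rw [e1]
    refine mul_le_mul_of_nonneg_left ?_ (by positivity)
    calc ∑ d ∈ Finset.Icc 1 ⌊2 * P4 D⌋₊, (d.divisors.card : ℝ) ^ 4 / d
        ≤ (1 + Real.log (⌊2 * P4 D⌋₊ : ℝ)) ^ (2 ^ 4) := sum_card_divisors_pow_div_le_log_pow 4 _
      _ = (1 + Real.log (⌊2 * P4 D⌋₊ : ℝ)) ^ 16 := by norm_num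
      _ ≤ (2 * L ^ 9) ^ 16 := by
          refine pow_le_pow_left₀ ?_ hlog2P4 16
          have : 0 ≤ Real.log (⌊2 * P4 D⌋₊ : ℝ) := Real.log_natCast_nonneg _
          linarith
  -- Step 7: assembling and absorbing the powers of `𝓛`
  have hfinal : (D : ℝ) ^ 3 * M * (3 * L ^ 9) * (2 * L ^ 9) ^ 16 ≤
      1 * bigP D ^ 2 * (D : ℝ) ^ (-(A : ℝ)) := by
    have habs' : 12 * 2 ^ 16 * C₀ * L ^ 171 ≤ D := habs D (by omega)
    have e12 : (D : ℝ) ^ (-((A + 12 : ℕ) : ℝ)) = (D : ℝ) ^ (-(A : ℝ)) * ((D : ℝ) ^ 12)⁻¹ := by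
      rw [show (-((A + 12 : ℕ) : ℝ)) = (-(A : ℝ)) + (-((12 : ℕ) : ℝ)) by push_cast; ring,
        Real.rpow_add hD0, Real.rpow_neg hD0.le ((12 : ℕ) : ℝ), Real.rpow_natCast]
    have hDA0 : 0 ≤ (D : ℝ) ^ (-(A : ℝ)) := Real.rpow_nonneg hD0.le _
    have eLHS : (D : ℝ) ^ 3 * M * (3 * L ^ 9) * (2 * L ^ 9) ^ 16 =
        ((12 * 2 ^ 16 * C₀ * L ^ 171) * ((D : ℝ) ^ 11 * ((D : ℝ) ^ 12)⁻¹)) *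
          (P ^ 2 * (D : ℝ) ^ (-(A : ℝ))) := by
      simp only [hM]; rw [e12]; ring
    have e11 : (D : ℝ) ^ 11 * ((D : ℝ) ^ 12)⁻¹ = ((D : ℝ))⁻¹ := by
      field_simp
    rw [eLHS, e11, one_mul]
    have h1 : (12 * 2 ^ 16 * C₀ * L ^ 171) * ((D : ℝ))⁻¹ ≤ 1 := by
      rw [mul_inv_le_iff₀ hD0, one_mul]; exact habs'
    calc (12 * 2 ^ 16 * C₀ * L ^ 171) * ((D : ℝ))⁻¹ * (P ^ 2 * (D : ℝ) ^ (-(A : ℝ)))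
        ≤ 1 * (P ^ 2 * (D : ℝ) ^ (-(A : ℝ))) := mul_le_mul_of_nonneg_right h1 (by positivity)
      _ = bigP D ^ 2 * (D : ℝ) ^ (-(A : ℝ)) := by rw [one_mul, hPdef]
  -- the chain
  calc ∑ d ∈ Finset.Icc 1 ⌊2 * P4 D⌋₊, (d : ℝ)⁻¹ * ∑ r ∈ S, ∑ h ∈ G r,
          (N : ℝ) / ((Nat.totient (h * r) : ℝ) * h * Real.sqrt r) *
            ∑ θ ∈ finsetOf {θ : DirichletCharacter ℂ r | θ.IsPrimitive ∧
                DirichletCharacter.changeLevel (dvd_mul_left r D) θ ≠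
                  DirichletCharacter.changeLevel (dvd_mul_right D r) χ},
              ‖∑' l : ℕ, if Nat.Coprime l h then
                  κs (D₁ * d * l) * θ (l : ZMod r) *
                    ∑ p ∈ primeWindow D, χ (p : ZMod D) * θ⁻¹ (p : ZMod r) * wt D β p *
                      DeltaW D ((l : ℝ) / ((p : ℝ) * h * r)) else 0‖
      ≤ ∑ d ∈ Finset.Icc 1 ⌊2 * P4 D⌋₊, (d : ℝ)⁻¹ *
          ((D : ℝ) ^ 3 * (M * (d.divisors.card : ℝ) ^ 4 * (3 * L ^ 9))) := by
        refine Finset.sum_le_sum fun d _ => ?_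
        exact mul_le_mul_of_nonneg_left (hsumr d) (by positivity)
    _ ≤ (D : ℝ) ^ 3 * M * (3 * L ^ 9) * (2 * L ^ 9) ^ 16 := hsumd
    _ ≤ 1 * bigP D ^ 2 * (D : ℝ) ^ (-(A : ℝ)) := hfinal

/-! ## The instance at modulus base `N = D₂`: the first leg of (14.6) at general `β` -/

/-- **leg1₂ — the small-conductor leg of (14.6) at general `β`** (p. 79, tex L3966–L3969: "the proof of
(14.6) is analogous … the main terms … do not appear"; first `r`-range "Mellin transform, Lemma 5.4 (i)
and Lemma 5.6", tex L3960–L3962): EXACTLY the hypothesis `hleg1` of `Typed.Sec14.eq146W_of_legs`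
(`Section14Eq146W`) — for every `B` there are `c > 0`, `C` with, for all large `D` under (A), all
`|β| < 5α`, all `κ*, a*` under (14.1)–(14.2) and every factorisation `D = D₁D₂` with `D₁ > 1`, the
re-indexed non-principal majorant at modulus base `D₂` (coefficients `κ*(D₁d·)`, weight `(pt₀)^β`) on
`(Icc 2 ⌊2D₂P₄⌋).filter (r < D³)` is `≤ C·P²·D^{−c}` (`c = 1`). Instance of `coreSmall_sum_le` at
`N := D₂ ≤ D`, `D₁ ≤ D`, `A := 1` (helper of the leg1₂ node; the `r ≥ D³` twin is `eq146leg2_of_core`).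
[cite: Zhang2022LandauSiegel, §14 (14.6) p.79, tex L3966–L3969; (14.8) p.79, tex L3960–L3962] -/
theorem eq146leg1W_holds :
    ∀ B : ℝ, ∃ c : ℝ, 0 < c ∧ ∃ C : ℝ, ForAllLarge fun D _ χ => AssumptionA D χ →
      ∀ β : ℂ, ‖β‖ < 5 * alpha D → ∀ κs as : ℕ → ℂ, Eq141 B κs → Eq142 D B as →
        ∀ D₁ D₂ : ℕ, D₁ * D₂ = D → 1 < D₁ →
          ∑ d ∈ Finset.Icc 1 ⌊2 * P4 D⌋₊, (d : ℝ)⁻¹ *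
            ∑ r ∈ (Finset.Icc 2 ⌊2 * (D₂ : ℝ) * P4 D⌋₊).filter (fun r => r < D ^ 3),
              ∑ h ∈ (Finset.Ico 1 ⌈bigP D / r⌉₊).filter (fun h => D₂ / Nat.gcd D₂ r ∣ h),
                (D₂ : ℝ) / ((Nat.totient (h * r) : ℝ) * h * Real.sqrt r) *
                  ∑ θ' ∈ finsetOf {θ' : DirichletCharacter ℂ r | θ'.IsPrimitive ∧
                      DirichletCharacter.changeLevel (dvd_mul_left r D) θ' ≠
                        DirichletCharacter.changeLevel (dvd_mul_right D r) χ},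
                    ‖∑' l : ℕ, if Nat.Coprime l h then κs (D₁ * d * l) * θ' (l : ZMod r) *
                        ∑ p ∈ primeWindow D, χ (p : ZMod D) * θ'⁻¹ (p : ZMod r) * wt D β p *
                        DeltaW D ((l : ℝ) / ((p : ℝ) * h * r)) else 0‖
          ≤ C * bigP D ^ 2 * (D : ℝ) ^ (-c) := by
  classical
  intro B
  obtain ⟨C, -, D₀, h⟩ := coreSmall_sum_le 1 B
  refine ⟨1, one_pos, C, D₀, fun D _ χ hD hq hp hA β hβ κs as hκ _ D₁ D₂ hD₁₂ hD₁ => ?_⟩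
  have hDpos : 0 < D := Nat.pos_of_ne_zero (NeZero.ne D)
  have hD₂pos : 0 < D₂ := Nat.pos_of_ne_zero fun h0 => by subst h0; rw [mul_zero] at hD₁₂; omega
  have hD₂D : D₂ ≤ D := by rw [← hD₁₂]; exact Nat.le_mul_of_pos_left D₂ (by omega)
  have hD₁D : D₁ ≤ D := by rw [← hD₁₂]; exact Nat.le_mul_of_pos_right D₁ hD₂pos
  have hS : ∀ r ∈ (Finset.Icc 2 ⌊2 * (D₂ : ℝ) * P4 D⌋₊).filter (fun r => r < D ^ 3),
      2 ≤ r ∧ r < D ^ 3 := fun r hr => by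
    obtain ⟨hr1, hr3⟩ := Finset.mem_filter.mp hr
    exact ⟨(Finset.mem_Icc.mp hr1).1, hr3⟩
  have hG : ∀ r ∈ (Finset.Icc 2 ⌊2 * (D₂ : ℝ) * P4 D⌋₊).filter (fun r => r < D ^ 3),
      (Finset.Ico 1 ⌈bigP D / r⌉₊).filter (fun h => D₂ / Nat.gcd D₂ r ∣ h) ⊆
        Finset.Ico 1 ⌈bigP D / r⌉₊ := fun r _ => Finset.filter_subset _ _
  have h1 := h D χ hD hq hp hA β hβ.le κs hκ D₂ D₁ hD₂D hD₁D _ hS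
    (fun r => (Finset.Ico 1 ⌈bigP D / r⌉₊).filter (fun h => D₂ / Nat.gcd D₂ r ∣ h)) hG
  simp only [Nat.cast_one] at h1
  exact h1

end Literature.NumberTheory.LFunctions.Zhang2022.Typed.Sec14
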